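import Summits.NavierStokesRegularity.NavierStokesRegularity.Theorems.PoloidalWindowDoorPoloidalWindowRigidityZShockNoLocalizedBreatherTools
import HarnessLib

/-!
# Crux K2 `PoloidalWindowRigidity` (stmt-NavierStokesRegularity-19708), line `z_shock` — the virial law on an ARBITRARY height window:
# identity without periodicity, size of the cut-off moment, and the uniform thin-shell selection lemma

`--supports stmt-NavierStokesRegularity-19708 --as helper` (leafhand-ns-poloidalwindowdoor-3 g11, cell decomp-ns, 2026-08-31).  Def-free; sequel of
`…ZShockVirialLaw`, `…ZShockPeriodicVirial`, `…ZShockBreatherBound`, `…ZShockNoLocalizedBreatherTools` (this seat); consumed by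
`…ZShockLocalizedRelaxation` (relaxation in the mean of localised patterns, no periodicity).  **No stub and no summit is closed by this file;
Navier–Stokes regularity is NOT proved here (rung 0).**

The periodic hypothesis of `…ZShockNoLocalizedBreather.no_localized_breather` is used there only to cancel the height-boundary terms
`M_a(s₂) − M_a(s₁)` of the cut-off virial moment `M_a(s) = ∫ χ_a (y·u)(w − w⋆) dy`.  Those terms are `O(a·B)` for a pattern of horizontal energy
`≤ B`, which is what the sequel needs:

* `exists_index_bound` — the selection lemma of `…NoLocalizedBreatherTools` with an A-PRIORI bound `N₀(D, a, ε)` on the selected index, valid for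
  every non-negative sequence with partial sums `≤ D` (uniformity over height windows);
* `virial_window_identity` — `∫_{s₁}^{s₂}∫ χ_a(−2Θ(w)) = M_a(s₂) − M_a(s₁) − ∫_{s₁}^{s₂}∫ χ_a'(⟨y⟩)⟨y⟩⁻¹ Σᵢ yᵢfᵢ` for EVERY height window of a jointly
  smooth solution of the autonomous height-evolution (FTC for the `c = 0` cone energy of `…ZShockLocalEnergy`; no periodicity);
* `abs_moment_le` — `|M_a(s)| ≤ (a+1)/2 · ∫(|u|² + (w − w⋆)²)(s, y) dy` for `a ≥ 0` (`|(y·u)(w−w⋆)| ≤ ⟨y⟩(|u|² + (w−w⋆)²)/2` and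
  `χ_a·⟨y⟩ ≤ a + 1`).
[folklore]
-/
noncomputable section

namespace Summit.NavierStokesRegularity.NavierStokesRegularity.Theorems.PoloidalWindowDoorPoloidalWindowRigidityZShockVirialWindow

-- the summit and its single sub-problem share the name (CONVENTIONS §1)
set_option linter.dupNamespace false

open Set Filter Topology Function MeasureTheory Metric
open scoped ContDiff
open Literature.Analysis.FluidPDE (continuousOn_integral_of_support_subset)
open Summit.NavierStokesRegularity.NavierStokesRegularity.Theorems.PoloidalWindowDoorPoloidalWindowRigidityZShockVirialLaw
open Summit.NavierStokesRegularity.NavierStokesRegularity.Theorems.PoloidalWindowDoorPoloidalWindowRigidityZShockLocalEnergyCutoff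
open Summit.NavierStokesRegularity.NavierStokesRegularity.Theorems.PoloidalWindowDoorPoloidalWindowRigidityZShockLocalEnergy
open Summit.NavierStokesRegularity.NavierStokesRegularity.Theorems.PoloidalWindowDoorPoloidalWindowRigidityZShockPeriodicVirial
open Summit.NavierStokesRegularity.NavierStokesRegularity.Theorems.PoloidalWindowDoorPoloidalWindowRigidityZShockBreatherBound
open Summit.NavierStokesRegularity.NavierStokesRegularity.Theorems.PoloidalWindowDoorPoloidalWindowRigidityZShockNoLocalizedBreatherTools

/-! ### Selection with an a-priori index bound -/

/-- **Selection lemma, uniform version.**  Given `D`, `a ≥ 0`, `ε > 0` there is `N₀` such that EVERY non-negative sequence with partial sums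
`≤ D` has an index `k < N₀` with `(a + 2k + 2)·h k < ε`. [folklore] -/
theorem exists_index_bound (D : ℝ) {a : ℝ} (ha : 0 ≤ a) {ε : ℝ} (hε : 0 < ε) :
    ∃ N₀ : ℕ, ∀ h : ℕ → ℝ, (∀ k, 0 ≤ h k) → (∀ N, ∑ k ∈ Finset.range N, h k ≤ D) →
      ∃ k : ℕ, k < N₀ ∧ (a + 2 * k + 2) * h k < ε := by
  have hc : 0 < ε / (a + 2) := by positivity
  obtain ⟨N₀, hN₀⟩ := (tendsto_atTop_atTop.1 Real.tendsto_sum_range_one_div_nat_succ_atTop) (D / (ε / (a + 2)) + 1)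
  refine ⟨N₀, fun h h0 hD => ?_⟩
  by_contra hcon
  push Not at hcon
  have hk : ∀ k : ℕ, k < N₀ → ε / (a + 2) * (1 / ((k : ℝ) + 1)) ≤ h k := by
    intro k hkN
    have h1 : (a + 2 * k + 2) ≤ (a + 2) * ((k : ℝ) + 1) := by nlinarith [(k : ℕ).cast_nonneg (α := ℝ)]
    have h3 := hcon k hkN
    rw [div_mul_div_comm, mul_one, div_le_iff₀ (by positivity)]
    calc ε ≤ (a + 2 * k + 2) * h k := h3
      _ ≤ (a + 2) * ((k : ℝ) + 1) * h k := mul_le_mul_of_nonneg_right h1 (h0 k)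
      _ = h k * ((a + 2) * ((k : ℝ) + 1)) := by ring
  have hsum : ε / (a + 2) * ∑ k ∈ Finset.range N₀, (1 / ((k : ℝ) + 1)) ≤ D := by
    rw [Finset.mul_sum]
    exact (Finset.sum_le_sum fun k hk' => hk k (Finset.mem_range.1 hk')).trans (hD N₀)
  have h := hN₀ N₀ le_rfl
  rw [← le_div_iff₀' hc] at hsum
  linarith

/-! ### The virial identity and inequality on an arbitrary height window -/

variable {u : Fin 2 → ℝ → EuclideanSpace ℝ (Fin 2) → ℝ} {w : ℝ → EuclideanSpace ℝ (Fin 2) → ℝ} {G Θ : ℝ → ℝ}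
  {wstar γlo γhi B : ℝ}

/-- **The virial identity on a height window** (no periodicity): `∫_{s₁}^{s₂}∫ χ_a σ = M_a(s₂) − M_a(s₁) − ∫_{s₁}^{s₂}∫ χ_a'⟨y⟩⁻¹ Σ yᵢfᵢ`. [folklore] -/
theorem virial_window_identity (hu : ∀ i, ContDiff ℝ ∞ (uncurry (u i))) (hw : ContDiff ℝ ∞ (uncurry w))
    (hΘs : ContDiff ℝ ∞ Θ) (hΘ : ∀ r, HasDerivAt Θ ((r - wstar) * G r) r)
    (hus : ∀ i s y, HasDerivAt (fun s' => u i s' y) (G (w s y) * fderiv ℝ (w s) y (EuclideanSpace.single i 1)) s)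
    (hws : ∀ s y, HasDerivAt (fun s' => w s' y)
      (-(fderiv ℝ (u 0 s) y (EuclideanSpace.single 0 1) + fderiv ℝ (u 1 s) y (EuclideanSpace.single 1 1))) s)
    (hpol : ∀ s y, fderiv ℝ (u 0 s) y (EuclideanSpace.single 1 1) = fderiv ℝ (u 1 s) y (EuclideanSpace.single 0 1))
    (a s₁ s₂ : ℝ) :
    ∫ s in s₁..s₂, ∫ y : EuclideanSpace ℝ (Fin 2),
        Real.smoothTransition (a + 1 - (√(1 + ‖y‖ ^ 2) + 0 * s)) * (-2 * Θ (w s y)) =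
      (∫ y : EuclideanSpace ℝ (Fin 2), Real.smoothTransition (a + 1 - (√(1 + ‖y‖ ^ 2) + 0 * s₂)) *
          ((y 0 * u 0 s₂ y + y 1 * u 1 s₂ y) * (w s₂ y - wstar))) -
      (∫ y : EuclideanSpace ℝ (Fin 2), Real.smoothTransition (a + 1 - (√(1 + ‖y‖ ^ 2) + 0 * s₁)) *
          ((y 0 * u 0 s₁ y + y 1 * u 1 s₁ y) * (w s₁ y - wstar))) -
      ∫ s in s₁..s₂, ∫ y : EuclideanSpace ℝ (Fin 2),
        deriv (fun v : ℝ => Real.smoothTransition (a + 1 - v)) (√(1 + ‖y‖ ^ 2) + 0 * s) / √(1 + ‖y‖ ^ 2) *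
          (0 * √(1 + ‖y‖ ^ 2) * ((y 0 * u 0 s y + y 1 * u 1 s y) * (w s y - wstar)) +
            ∑ i : Fin 2, y i * ((y 0 * u 0 s y + y 1 * u 1 s y) * u i s y
              - (1 / 2) * (u 0 s y ^ 2 + u 1 s y ^ 2) * y i - Θ (w s y) * y i)) := by
  -- the densities
  set e : ℝ → EuclideanSpace ℝ (Fin 2) → ℝ := fun s y => (y 0 * u 0 s y + y 1 * u 1 s y) * (w s y - wstar) with he_def
  set f : Fin 2 → ℝ → EuclideanSpace ℝ (Fin 2) → ℝ := fun i s y =>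
    (y 0 * u 0 s y + y 1 * u 1 s y) * u i s y - (1 / 2) * (u 0 s y ^ 2 + u 1 s y ^ 2) * y i - Θ (w s y) * y i with hf_def
  set σ : ℝ → EuclideanSpace ℝ (Fin 2) → ℝ := fun s y => -2 * Θ (w s y) with hσ_def
  have he : ContDiff ℝ ∞ (uncurry e) := smooth_moment hu hw wstar
  have hf : ∀ i, ContDiff ℝ ∞ (uncurry (f i)) := fun i => smooth_flux hu hw hΘs i
  have hσ : ContDiff ℝ ∞ (uncurry σ) := smooth_bulk hw hΘs
  have hbal : ∀ s y, deriv (fun s' => e s' y) s + ∑ i, fderiv ℝ (f i s) y (EuclideanSpace.single i 1) = σ s y :=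
    fun s y => virial_balance hu hw hΘ hus hws hpol s y
  set M : ℝ → ℝ := fun s' => ∫ y : EuclideanSpace ℝ (Fin 2),
    Real.smoothTransition (a + 1 - (√(1 + ‖y‖ ^ 2) + 0 * s')) * e s' y with hM_def
  set T : ℝ → ℝ := fun s => ∫ y : EuclideanSpace ℝ (Fin 2),
    deriv (fun v : ℝ => Real.smoothTransition (a + 1 - v)) (√(1 + ‖y‖ ^ 2) + 0 * s) / √(1 + ‖y‖ ^ 2) *
      (0 * √(1 + ‖y‖ ^ 2) * e s y + ∑ i, y i * f i s y) with hT_def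
  set S : ℝ → ℝ := fun s => ∫ y : EuclideanSpace ℝ (Fin 2),
    Real.smoothTransition (a + 1 - (√(1 + ‖y‖ ^ 2) + 0 * s)) * σ s y with hS_def
  have hMd : ∀ s, HasDerivAt M (T s + S s) s := fun s => hasDerivAt_coneEnergy he hf hσ hbal a 0 s
  have hK : IsCompact (closedBall (0 : EuclideanSpace ℝ (Fin 2)) (a + 1)) := isCompact_closedBall _ _
  have hout : ∀ s : ℝ, ∀ y ∉ closedBall (0 : EuclideanSpace ℝ (Fin 2)) (a + 1), a + 1 - 0 * s < ‖y‖ := by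
    intro s y hy
    rw [mem_closedBall, dist_zero_right, not_le] at hy
    simpa using hy
  have hbr : ContDiff ℝ ∞ fun p : ℝ × EuclideanSpace ℝ (Fin 2) => √(1 + ‖p.2‖ ^ 2) + 0 * p.1 :=
    (contDiff_bracket.comp contDiff_snd).add (contDiff_const.mul contDiff_fst)
  have hTc : Continuous T := by
    have hΦ : Continuous fun p : ℝ × EuclideanSpace ℝ (Fin 2) =>
        deriv (fun v : ℝ => Real.smoothTransition (a + 1 - v)) (√(1 + ‖p.2‖ ^ 2) + 0 * p.1) / √(1 + ‖p.2‖ ^ 2) *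
          (0 * √(1 + ‖p.2‖ ^ 2) * e p.1 p.2 + ∑ i, p.2 i * f i p.1 p.2) := by
      refine ((((contDiff_profile (a + 1) (k := ⊤)).continuous_deriv (by simp)).comp hbr.continuous).div
        (contDiff_bracket.comp contDiff_snd (n := (⊤ : ℕ∞))).continuous fun p => (bracket_pos p.2).ne').mul ?_
      refine ((continuous_const.mul (contDiff_bracket.comp contDiff_snd (n := (⊤ : ℕ∞))).continuous).mul
        he.continuous).add ?_
      exact continuous_finsetSum _ fun i _ => (contDiff_snd_coord i).continuous.mul (hf i).continuous
    have h := continuousOn_integral_of_support_subset (μ := (volume : Measure (EuclideanSpace ℝ (Fin 2))))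
      (S := univ) (Φ := fun s (y : EuclideanSpace ℝ (Fin 2)) =>
        deriv (fun v : ℝ => Real.smoothTransition (a + 1 - v)) (√(1 + ‖y‖ ^ 2) + 0 * s) / √(1 + ‖y‖ ^ 2) *
          (0 * √(1 + ‖y‖ ^ 2) * e s y + ∑ i, y i * f i s y)) hK hΦ.continuousOn (fun s _ y hy => by
        show deriv (fun v : ℝ => Real.smoothTransition (a + 1 - v)) (√(1 + ‖y‖ ^ 2) + 0 * s) / √(1 + ‖y‖ ^ 2) *
          (0 * √(1 + ‖y‖ ^ 2) * e s y + ∑ i, y i * f i s y) = 0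
        rw [deriv_cutoff_eq_zero (hout s y hy)]; simp)
    exact continuousOn_univ.1 h
  have hSc : Continuous S := by
    have hΦ : Continuous fun p : ℝ × EuclideanSpace ℝ (Fin 2) =>
        Real.smoothTransition (a + 1 - (√(1 + ‖p.2‖ ^ 2) + 0 * p.1)) * σ p.1 p.2 :=
      (contDiff_cutoff_uncurry a 0 (n := 2)).continuous.mul hσ.continuous
    have h := continuousOn_integral_of_support_subset (μ := (volume : Measure (EuclideanSpace ℝ (Fin 2))))
      (S := univ) (Φ := fun s (y : EuclideanSpace ℝ (Fin 2)) =>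
        Real.smoothTransition (a + 1 - (√(1 + ‖y‖ ^ 2) + 0 * s)) * σ s y) hK hΦ.continuousOn (fun s _ y hy => by
        show Real.smoothTransition (a + 1 - (√(1 + ‖y‖ ^ 2) + 0 * s)) * σ s y = 0
        rw [cutoff_eq_zero (hout s y hy), zero_mul])
    exact continuousOn_univ.1 h
  have hFTC : ∫ s in s₁..s₂, (T s + S s) = M s₂ - M s₁ :=
    intervalIntegral.integral_eq_sub_of_hasDerivAt (fun s _ => hMd s) ((hTc.add hSc).intervalIntegrable _ _)
  rw [intervalIntegral.integral_add (hTc.intervalIntegrable _ _) (hSc.intervalIntegrable _ _)] at hFTC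
  have hST : ∫ s in s₁..s₂, S s = M s₂ - M s₁ - ∫ s in s₁..s₂, T s := by linarith
  simpa only [hS_def, hT_def, hM_def, hσ_def, he_def, hf_def] using hST

/-- **Size of the cut-off virial moment**: `|M_a(s)| ≤ (a+1)/2 · ∫(|u|² + (w−w⋆)²)`, for `a ≥ 0`. [folklore] -/
theorem abs_moment_le (hu : ∀ i, ContDiff ℝ ∞ (uncurry (u i))) (hw : ContDiff ℝ ∞ (uncurry w)) {a : ℝ} (ha : 0 ≤ a) (s : ℝ)
    (hint : Integrable fun y => u 0 s y ^ 2 + u 1 s y ^ 2 + (w s y - wstar) ^ 2) :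
    |∫ y : EuclideanSpace ℝ (Fin 2), Real.smoothTransition (a + 1 - √(1 + ‖y‖ ^ 2)) *
        ((y 0 * u 0 s y + y 1 * u 1 s y) * (w s y - wstar))| ≤
      (a + 1) / 2 * ∫ y, (u 0 s y ^ 2 + u 1 s y ^ 2 + (w s y - wstar) ^ 2) := by
  rw [← integral_const_mul]
  refine (abs_integral_le_integral_abs).trans (integral_mono ?_ (hint.const_mul _) fun y => ?_)
  · exact ((continuous_cutoff a).mul ((contDiff_slice (smooth_moment hu hw wstar) s).continuous)).abs.integrable_of_hasCompactSupport
      ((hasCompactSupport_of_eq_zero (cutoff_zero_of_lt a)).mul_right).abs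
  -- pointwise: `|χ m| ≤ (a+1)/2 (|u|² + d²)`
  have hχ0 : 0 ≤ Real.smoothTransition (a + 1 - √(1 + ‖y‖ ^ 2)) := Real.smoothTransition.nonneg _
  have hχ1 : Real.smoothTransition (a + 1 - √(1 + ‖y‖ ^ 2)) ≤ 1 := Real.smoothTransition.le_one _
  have hb := bracket_pos y
  have hn : ‖y‖ ^ 2 = y 0 ^ 2 + y 1 ^ 2 := by
    rw [EuclideanSpace.norm_sq_eq, Fin.sum_univ_two]; simp [sq_abs]
  have hyb : y 0 ^ 2 + y 1 ^ 2 ≤ √(1 + ‖y‖ ^ 2) ^ 2 := by rw [Real.sq_sqrt (by positivity), ← hn]; linarith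
  -- `χ · ⟨y⟩ ≤ a + 1`
  have hχb : Real.smoothTransition (a + 1 - √(1 + ‖y‖ ^ 2)) * √(1 + ‖y‖ ^ 2) ≤ a + 1 := by
    by_cases hlt : √(1 + ‖y‖ ^ 2) < a + 1
    · nlinarith
    · rw [Real.smoothTransition.zero_of_nonpos (by linarith), zero_mul]; linarith
  rw [abs_mul, abs_of_nonneg hχ0]
  -- `|m| ≤ ⟨y⟩ (|u|² + d²)/2`
  have hm : |(y 0 * u 0 s y + y 1 * u 1 s y) * (w s y - wstar)| ≤
      √(1 + ‖y‖ ^ 2) * ((u 0 s y ^ 2 + u 1 s y ^ 2 + (w s y - wstar) ^ 2) / 2) := by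
    rw [abs_le]
    have hcs : (y 0 * u 0 s y + y 1 * u 1 s y) ^ 2 ≤ (y 0 ^ 2 + y 1 ^ 2) * (u 0 s y ^ 2 + u 1 s y ^ 2) := by
      nlinarith [sq_nonneg (y 0 * u 1 s y - y 1 * u 0 s y)]
    have hyu : |y 0 * u 0 s y + y 1 * u 1 s y| ≤ √(1 + ‖y‖ ^ 2) * √(u 0 s y ^ 2 + u 1 s y ^ 2) := by
      rw [← Real.sqrt_sq (abs_nonneg _), sq_abs, ← Real.sqrt_mul (by positivity)]
      have hyb' : y 0 ^ 2 + y 1 ^ 2 ≤ 1 + ‖y‖ ^ 2 := by rw [hn]; linarith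
      exact Real.sqrt_le_sqrt (hcs.trans (mul_le_mul_of_nonneg_right hyb' (by positivity)))
    have hU := Real.sq_sqrt (show 0 ≤ u 0 s y ^ 2 + u 1 s y ^ 2 by positivity)
    have hU0 := Real.sqrt_nonneg (u 0 s y ^ 2 + u 1 s y ^ 2)
    have key : |(y 0 * u 0 s y + y 1 * u 1 s y) * (w s y - wstar)| ≤
        √(1 + ‖y‖ ^ 2) * ((u 0 s y ^ 2 + u 1 s y ^ 2 + (w s y - wstar) ^ 2) / 2) := by
      rw [abs_mul]
      calc |y 0 * u 0 s y + y 1 * u 1 s y| * |w s y - wstar|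
          ≤ (√(1 + ‖y‖ ^ 2) * √(u 0 s y ^ 2 + u 1 s y ^ 2)) * |w s y - wstar| :=
            mul_le_mul_of_nonneg_right hyu (abs_nonneg _)
        _ = √(1 + ‖y‖ ^ 2) * (√(u 0 s y ^ 2 + u 1 s y ^ 2) * |w s y - wstar|) := by ring
        _ ≤ √(1 + ‖y‖ ^ 2) * ((u 0 s y ^ 2 + u 1 s y ^ 2 + (w s y - wstar) ^ 2) / 2) := by
            refine mul_le_mul_of_nonneg_left ?_ hb.le
            nlinarith [sq_nonneg (√(u 0 s y ^ 2 + u 1 s y ^ 2) - |w s y - wstar|), sq_abs (w s y - wstar), abs_nonneg (w s y - wstar)]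
    exact abs_le.1 key
  have hpos : 0 ≤ u 0 s y ^ 2 + u 1 s y ^ 2 + (w s y - wstar) ^ 2 := by positivity
  calc Real.smoothTransition (a + 1 - √(1 + ‖y‖ ^ 2)) * |(y 0 * u 0 s y + y 1 * u 1 s y) * (w s y - wstar)|
      ≤ Real.smoothTransition (a + 1 - √(1 + ‖y‖ ^ 2)) * (√(1 + ‖y‖ ^ 2) * ((u 0 s y ^ 2 + u 1 s y ^ 2 + (w s y - wstar) ^ 2) / 2)) :=
        mul_le_mul_of_nonneg_left hm hχ0
    _ = (Real.smoothTransition (a + 1 - √(1 + ‖y‖ ^ 2)) * √(1 + ‖y‖ ^ 2)) * ((u 0 s y ^ 2 + u 1 s y ^ 2 + (w s y - wstar) ^ 2) / 2) := by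
        ring
    _ ≤ (a + 1) * ((u 0 s y ^ 2 + u 1 s y ^ 2 + (w s y - wstar) ^ 2) / 2) := mul_le_mul_of_nonneg_right hχb (by positivity)
    _ = (a + 1) / 2 * (u 0 s y ^ 2 + u 1 s y ^ 2 + (w s y - wstar) ^ 2) := by ring

end Summit.NavierStokesRegularity.NavierStokesRegularity.Theorems.PoloidalWindowDoorPoloidalWindowRigidityZShockVirialWindow

end
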